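import Literature.MathematicalPhysics.QuantumLattice.HubbardNNNHoppingWeightedOpenBox
import Literature.MathematicalPhysics.QuantumLattice.HubbardTPPBoxHamiltonian
import HarnessLib

/-!
# The WEIGHTED open `r × c` cluster of the `t–t'–t''–U` model (object M): definition, symmetries,
# and the weighted bond count by direction for two-point functions

Topic `MathematicalPhysics/QuantumLattice`, family `hubbard` (seat hubbard-box-p3, S2 CERTIFIER-FAMILIES,
hypothesis-free tier, object M of the material-oracle seam). Sequel of `HubbardNNNHoppingWeightedOpenBox`
(the weighted `t–t'–U` cluster `hubbardOpenBoxTT'W r c τ υ ν` of the Valentí–Stolze–Hirschfeld cover) and of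
`HubbardTPPBoxHamiltonian` (the third-neighbour bonds `rectBoxAxial2Graph` and the uniform `t–t'–t''` cluster
`hubbardOpenBoxTT'T''`). The weighted `t–t'–t''` cluster is

  `h^{W,M} = hubbardOpenBoxTT'W r c τ υ ν + hamiltonian (rectBoxAxial2Graph r c) a 0`

(`hubbardOpenBoxTT'T''W r c τ υ ν a`): position-dependent nearest-neighbour / diagonal bond weights `τ`,
site repulsions `υ`, on-site potentials `ν`, and a UNIFORM third-neighbour amplitude `a` (in the `2 × 3`
cluster the two third-neighbour bonds are equivalent under the box symmetry, so a uniform axial weight loses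
nothing there). §1: unfolding, the `a = 0` and uniform-weight reductions (`…_zero`, `…_uniform`), Hermiticity,
particle-number conservation, covariance under the coordinate swap and equality of the sector ground-state
energies of the `r × c` and the transposed `c × r` cluster (`groundEnergy_hubbardOpenBoxTT'T''W_swap`: ONE
kernel table serves both orientations). §2: the model-free bookkeeping identity behind every weighted cover —
**the weighted bond count by direction for a two-point function** (`sum_ite_boxAdj_mul_eq_wsums`): for
symmetric `τ` and any `F : box × box → ℂ` whose symmetrised values `F(p,q) + F(q,p)` are constant on each of the
four bond directions (`K_V, K_H, K_{D₁}, K_{D₂}`),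
`Σ_{p,q adjacent} τ(p,q) F(p,q) = wsumV τ·K_V + wsumH τ·K_H + wsumD₁ τ·K_{D₁} + wsumD₂ τ·K_{D₂}`
(the infinite-volume twin of `ClusterLowerBound.sum_smul_ite_boxAdj_hopDir`, which is the torus instance
`F = T_{q-p}`). The infinite-volume cluster floor for object M built on these is
`HubbardTPPWeightedClusterFloorInfVol`.

References: P. W. Anderson, Phys. Rev. 83 (1951) 1260, eq. (2) [cite: Anderson1951, eq. (2)];
R. Valentí, J. Stolze, P. J. Hirschfeld, Phys. Rev. B 43 (1991) 13743, §II (weighted clusters)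
[cite: ValentiStolzeHirschfeld1991, §II]; E. Pavarini et al., Phys. Rev. Lett. 87 (2001) 047003, eq. (1)
(the `t–t'–t''` one-band model) [cite: PavariniEtAl2001, eq. (1)]; Bratteli–Robinson II §5.2.2 (covariance of
second quantisation) [cite: BratteliRobinsonII1997, §5.2.2]. Everything is proved; one definition with body;
no named facts, no instances, no notation.
-/

noncomputable section

namespace Literature.MathematicalPhysics.QuantumLattice

open Matrix Finset HubbardWave0
open scoped ComplexOrder

namespace ClusterLowerBound

variable {r c : ℕ}

/-! ### §1. The weighted `t–t'–t''` cluster -/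

/-- **The weighted open `r × c` cluster of the `t–t'–t''–U` model**:
`h^{W,M} = hubbardOpenBoxTT'W r c τ υ ν + hamiltonian (rectBoxAxial2Graph r c) a 0` — weighted nearest-neighbour
and diagonal bonds, weighted repulsion, on-site potentials, and a uniform third-neighbour hopping `a` on the
axial range-2 bonds of the open box. [cite: ValentiStolzeHirschfeld1991, §II] [cite: PavariniEtAl2001, eq. (1)] -/
def hubbardOpenBoxTT'T''W (r c : ℕ) (τ : Fin r ×ₗ Fin c → Fin r ×ₗ Fin c → ℝ) (υ ν : Fin r ×ₗ Fin c → ℝ) (a : ℝ) :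
    Matrix (Finset (Orb (Fin r ×ₗ Fin c))) (Finset (Orb (Fin r ×ₗ Fin c))) ℂ :=
  hubbardOpenBoxTT'W r c τ υ ν + hamiltonian (rectBoxAxial2Graph r c) a 0

/-- Unfolding. [cite: PavariniEtAl2001, eq. (1)] -/
theorem hubbardOpenBoxTT'T''W_def (τ : Fin r ×ₗ Fin c → Fin r ×ₗ Fin c → ℝ) (υ ν : Fin r ×ₗ Fin c → ℝ) (a : ℝ) :
    hubbardOpenBoxTT'T''W r c τ υ ν a = hubbardOpenBoxTT'W r c τ υ ν + hamiltonian (rectBoxAxial2Graph r c) a 0 := rfl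

/-- At `a = 0` the weighted `t–t'–t''` cluster is the weighted `t–t'` cluster. [cite: ValentiStolzeHirschfeld1991, §II] -/
theorem hubbardOpenBoxTT'T''W_zero (τ : Fin r ×ₗ Fin c → Fin r ×ₗ Fin c → ℝ) (υ ν : Fin r ×ₗ Fin c → ℝ) :
    hubbardOpenBoxTT'T''W r c τ υ ν 0 = hubbardOpenBoxTT'W r c τ υ ν := by
  rw [hubbardOpenBoxTT'T''W, hamiltonian]
  simp

/-- **Uniform weights give the tree's `t–t'–t''` cluster**: `τ = t` on nearest-neighbour bonds, `τ = t'` on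
diagonal bonds, `υ = U`, `ν = 0`, `a = t''` ⇒ `h^{W,M} = hubbardOpenBoxTT'T'' r c t t' t'' U`. [cite: PavariniEtAl2001, eq. (1)] -/
theorem hubbardOpenBoxTT'T''W_uniform (r c : ℕ) (t t' t'' U : ℝ) :
    hubbardOpenBoxTT'T''W r c (fun x y => if (rectBoxGraph r c).Adj x y then t else t') (fun _ => U) (fun _ => 0) t'' =
      hubbardOpenBoxTT'T'' r c t t' t'' U := by
  rw [hubbardOpenBoxTT'T''W, hubbardOpenBoxTT'W_uniform, hubbardOpenBoxTT'T''_def]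

/-- `h^{W,M}` is Hermitian for symmetric weights. [cite: PavariniEtAl2001, eq. (1)] -/
theorem hubbardOpenBoxTT'T''W_isHermitian (τ : Fin r ×ₗ Fin c → Fin r ×ₗ Fin c → ℝ) (hτ : ∀ x y, τ x y = τ y x)
    (υ ν : Fin r ×ₗ Fin c → ℝ) (a : ℝ) : (hubbardOpenBoxTT'T''W r c τ υ ν a).IsHermitian := by
  rw [hubbardOpenBoxTT'T''W]
  exact (hubbardOpenBoxTT'W_isHermitian τ hτ υ ν).add (hamiltonian_isHermitian_and_commute_holds (rectBoxAxial2Graph r c) a 0).1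

/-- `h^{W,M}` conserves the particle number. [cite: PavariniEtAl2001, eq. (1)] -/
theorem hubbardOpenBoxTT'T''W_commute_totalNumber (τ : Fin r ×ₗ Fin c → Fin r ×ₗ Fin c → ℝ) (υ ν : Fin r ×ₗ Fin c → ℝ)
    (a : ℝ) : Commute (hubbardOpenBoxTT'T''W r c τ υ ν a) totalNumber := by
  rw [hubbardOpenBoxTT'T''W]
  exact (hubbardOpenBoxTT'W_commute_totalNumber τ υ ν).add_left
    (hamiltonian_isHermitian_and_commute_holds (rectBoxAxial2Graph r c) a 0).2.1

/-- Third-neighbour adjacency is carried by the coordinate swap. [folklore] -/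
private theorem rectBoxAxial2Graph_adj_rectSwap (x y : Fin r ×ₗ Fin c) :
    (rectBoxAxial2Graph c r).Adj (rectSwap r c x) (rectSwap r c y) ↔ (rectBoxAxial2Graph r c).Adj x y := by
  show ((ofLex x).1 = (ofLex y).1 ∧ line2Adj (ofLex x).2 (ofLex y).2) ∨
      ((ofLex x).2 = (ofLex y).2 ∧ line2Adj (ofLex x).1 (ofLex y).1) ↔
    ((ofLex x).2 = (ofLex y).2 ∧ line2Adj (ofLex x).1 (ofLex y).1) ∨
      ((ofLex x).1 = (ofLex y).1 ∧ line2Adj (ofLex x).2 (ofLex y).2)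
  exact Or.comm

/-- **Covariance under the coordinate swap**: relabelling along `rectSwap r c` carries `h^{W,M}_{r×c}(τ, υ, ν, a)` onto
`h^{W,M}_{c×r}(τᵀ, υᵀ, νᵀ, a)` (transposed weights; the axial term is swap invariant). [cite: BratteliRobinsonII1997, §5.2.2] -/
theorem relabel_rectSwap_hubbardOpenBoxTT'T''W (τ : Fin r ×ₗ Fin c → Fin r ×ₗ Fin c → ℝ) (υ ν : Fin r ×ₗ Fin c → ℝ)
    (a : ℝ) :
    relabel (Orb.mapEquiv (rectSwap r c)) (hubbardOpenBoxTT'T''W r c τ υ ν a) =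
      hubbardOpenBoxTT'T''W c r (fun p q => τ (rectSwap c r p) (rectSwap c r q)) (fun p => υ (rectSwap c r p))
        (fun p => ν (rectSwap c r p)) a := by
  rw [hubbardOpenBoxTT'T''W, hubbardOpenBoxTT'T''W, map_add, relabel_rectSwap_hubbardOpenBoxTT'W,
    relabel_hamiltonian (rectBoxAxial2Graph r c) (rectBoxAxial2Graph c r) (rectSwap r c)
      (fun x y => rectBoxAxial2Graph_adj_rectSwap x y) a 0]

/-- **One table serves both orientations**: the sector ground-state energies of the weighted `c × r`
`t–t'–t''` cluster with transposed weights are those of the weighted `r × c` cluster. [cite: BratteliRobinsonII1997, §5.2.2] -/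
theorem groundEnergy_hubbardOpenBoxTT'T''W_swap (τ : Fin r ×ₗ Fin c → Fin r ×ₗ Fin c → ℝ) (υ ν : Fin r ×ₗ Fin c → ℝ)
    (a : ℝ) (N : ℕ) :
    groundEnergy (hubbardOpenBoxTT'T''W c r (fun p q => τ (rectSwap c r p) (rectSwap c r q))
        (fun p => υ (rectSwap c r p)) (fun p => ν (rectSwap c r p)) a) N =
      groundEnergy (hubbardOpenBoxTT'T''W r c τ υ ν a) N := by
  rw [← relabel_rectSwap_hubbardOpenBoxTT'T''W, groundEnergy_relabel]

/-! ### §2. The weighted bond count by direction for a two-point function -/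

/-- **Nearest-neighbour box bonds by direction** (generic summand): an ordered pair `(p, q)` of box sites is a
nearest-neighbour bond iff it is one of the four unit steps `q = p ± e₁`, `q = p ± e₂`, and these are mutually
exclusive. [cite: Anderson1951, eq. (2)] -/
theorem ite_rectBoxGraph_adj_eq_sum_dirs {M : Type*} [AddCommMonoid M] (p q : Fin r ×ₗ Fin c) (T : M) :
    (if (rectBoxGraph r c).Adj p q then T else 0) =
      ((if ((ofLex p).1 : ℕ) + 1 = (ofLex q).1 ∧ (ofLex p).2 = (ofLex q).2 then T else 0) +
        (if ((ofLex q).1 : ℕ) + 1 = (ofLex p).1 ∧ (ofLex q).2 = (ofLex p).2 then T else 0)) +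
      ((if (ofLex p).1 = (ofLex q).1 ∧ ((ofLex p).2 : ℕ) + 1 = (ofLex q).2 then T else 0) +
        (if (ofLex q).1 = (ofLex p).1 ∧ ((ofLex q).2 : ℕ) + 1 = (ofLex p).2 then T else 0)) := by
  by_cases hA : (rectBoxGraph r c).Adj p q
  · rw [if_pos hA]
    change ((ofLex p).2 = (ofLex q).2 ∧ lineAdj (ofLex p).1 (ofLex q).1) ∨
      ((ofLex p).1 = (ofLex q).1 ∧ lineAdj (ofLex p).2 (ofLex q).2) at hA
    unfold lineAdj at hA
    rcases hA with ⟨hjj, h1 | h1⟩ | ⟨hii, h1 | h1⟩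
    · have hjj' := congrArg Fin.val hjj
      rw [if_pos ⟨h1, hjj⟩, if_neg (fun h => by omega), if_neg (fun h => by have := congrArg Fin.val h.1; omega),
        if_neg (fun h => by have := congrArg Fin.val h.1; omega), add_zero, add_zero, add_zero]
    · have hjj' := congrArg Fin.val hjj
      rw [if_neg (fun h => by omega), if_pos ⟨h1, hjj.symm⟩, if_neg (fun h => by have := congrArg Fin.val h.1; omega),
        if_neg (fun h => by have := congrArg Fin.val h.1; omega), zero_add, add_zero, add_zero]
    · have hii' := congrArg Fin.val hii
      rw [if_neg (fun h => by omega), if_neg (fun h => by omega), if_pos ⟨hii, h1⟩,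
        if_neg (fun h => by omega), zero_add, zero_add, add_zero]
    · have hii' := congrArg Fin.val hii
      rw [if_neg (fun h => by omega), if_neg (fun h => by omega), if_neg (fun h => by omega),
        if_pos ⟨hii.symm, h1⟩, zero_add, zero_add, zero_add]
  · rw [if_neg hA]
    change ¬(((ofLex p).2 = (ofLex q).2 ∧ lineAdj (ofLex p).1 (ofLex q).1) ∨
      ((ofLex p).1 = (ofLex q).1 ∧ lineAdj (ofLex p).2 (ofLex q).2)) at hA
    unfold lineAdj at hA
    rw [if_neg (fun h => hA (Or.inl ⟨h.2, Or.inl h.1⟩)), if_neg (fun h => hA (Or.inl ⟨h.2.symm, Or.inr h.1⟩)),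
      if_neg (fun h => hA (Or.inr ⟨h.1, Or.inl h.2⟩)), if_neg (fun h => hA (Or.inr ⟨h.1.symm, Or.inr h.2⟩)),
      add_zero, add_zero]

/-- **Diagonal box bonds by direction** (generic summand): `(p, q)` is a diagonal bond iff it is one of the four
steps `q = p ± (e₁ + e₂)`, `q = p ± (e₁ - e₂)`, mutually exclusive. [cite: Anderson1951, eq. (2)] -/
theorem ite_rectBoxDiagGraph_adj_eq_sum_dirs {M : Type*} [AddCommMonoid M] (p q : Fin r ×ₗ Fin c) (T : M) :
    (if (rectBoxDiagGraph r c).Adj p q then T else 0) =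
      ((if ((ofLex p).1 : ℕ) + 1 = (ofLex q).1 ∧ ((ofLex p).2 : ℕ) + 1 = (ofLex q).2 then T else 0) +
        (if ((ofLex q).1 : ℕ) + 1 = (ofLex p).1 ∧ ((ofLex q).2 : ℕ) + 1 = (ofLex p).2 then T else 0)) +
      ((if ((ofLex p).1 : ℕ) + 1 = (ofLex q).1 ∧ ((ofLex q).2 : ℕ) + 1 = (ofLex p).2 then T else 0) +
        (if ((ofLex q).1 : ℕ) + 1 = (ofLex p).1 ∧ ((ofLex p).2 : ℕ) + 1 = (ofLex q).2 then T else 0)) := by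
  by_cases hA : (rectBoxDiagGraph r c).Adj p q
  · rw [if_pos hA]
    change lineAdj (ofLex p).1 (ofLex q).1 ∧ lineAdj (ofLex p).2 (ofLex q).2 at hA
    unfold lineAdj at hA
    rcases hA with ⟨h1 | h1, h2 | h2⟩
    · rw [if_pos ⟨h1, h2⟩, if_neg (fun h => by omega), if_neg (fun h => by omega), if_neg (fun h => by omega),
        add_zero, add_zero, add_zero]
    · rw [if_neg (fun h => by omega), if_neg (fun h => by omega), if_pos ⟨h1, h2⟩, if_neg (fun h => by omega),
        zero_add, zero_add, add_zero]
    · rw [if_neg (fun h => by omega), if_neg (fun h => by omega), if_neg (fun h => by omega), if_pos ⟨h1, h2⟩,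
        zero_add, zero_add, zero_add]
    · rw [if_neg (fun h => by omega), if_pos ⟨h1, h2⟩, if_neg (fun h => by omega), if_neg (fun h => by omega),
        zero_add, add_zero, add_zero]
  · rw [if_neg hA]
    change ¬(lineAdj (ofLex p).1 (ofLex q).1 ∧ lineAdj (ofLex p).2 (ofLex q).2) at hA
    unfold lineAdj at hA
    rw [if_neg (fun h => hA ⟨Or.inl h.1, Or.inl h.2⟩), if_neg (fun h => hA ⟨Or.inr h.1, Or.inr h.2⟩),
      if_neg (fun h => hA ⟨Or.inl h.1, Or.inr h.2⟩), if_neg (fun h => hA ⟨Or.inr h.1, Or.inl h.2⟩),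
      add_zero, add_zero]

/-- Nearest-neighbour-or-diagonal adjacency splits into the two bond classes (they exclude each other).
[cite: LeBlancEtAl2015, eq. (1)] -/
theorem ite_boxAdj_or_eq_add {M : Type*} [AddCommMonoid M] (p q : Fin r ×ₗ Fin c) (T : M) :
    (if (rectBoxGraph r c).Adj p q ∨ (rectBoxDiagGraph r c).Adj p q then T else 0) =
      (if (rectBoxGraph r c).Adj p q then T else 0) + (if (rectBoxDiagGraph r c).Adj p q then T else 0) := by
  by_cases h1 : (rectBoxGraph r c).Adj p q
  · rw [if_pos (Or.inl h1), if_pos h1, if_neg (not_rectBoxDiagGraph_adj_of_rectBoxGraph_adj h1), add_zero]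
  · by_cases h2 : (rectBoxDiagGraph r c).Adj p q
    · rw [if_pos (Or.inr h2), if_neg h1, if_pos h2, zero_add]
    · rw [if_neg (fun h => h.elim h1 h2), if_neg h1, if_neg h2, add_zero]

/-- **Directed pair sums, one direction class**: for symmetric weights `τ` and a two-point function `F` with
`F(p,q) + F(q,p) = K` on the class `cnd`, the forward and the reversed weighted sums add up to
`(Σ_{cnd p q} τ(p,q)) · K`. [cite: ValentiStolzeHirschfeld1991, §II] -/
theorem sum_ite_add_sum_ite_rev_eq_mul {ι : Type*} [Fintype ι] (cnd : ι → ι → Prop) [∀ p q, Decidable (cnd p q)]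
    (τ : ι → ι → ℝ) (hτ : ∀ x y, τ x y = τ y x) (F : ι → ι → ℂ) {K : ℂ} (hK : ∀ p q, cnd p q → F p q + F q p = K) :
    ((∑ p, ∑ q, if cnd p q then (τ p q : ℂ) * F p q else 0) + ∑ p, ∑ q, if cnd q p then (τ p q : ℂ) * F p q else 0) =
      ((∑ p, ∑ q, if cnd p q then τ p q else 0 : ℝ) : ℂ) * K := by
  have hrev : (∑ p, ∑ q, if cnd q p then (τ p q : ℂ) * F p q else 0) =
      ∑ p, ∑ q, if cnd p q then (τ p q : ℂ) * F q p else 0 := by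
    rw [Finset.sum_comm]
    refine Finset.sum_congr rfl fun p _ => Finset.sum_congr rfl fun q _ => ?_
    rw [hτ q p]
  rw [hrev, ← Finset.sum_add_distrib, Complex.ofReal_sum, Finset.sum_mul]
  refine Finset.sum_congr rfl fun p _ => ?_
  rw [← Finset.sum_add_distrib, Complex.ofReal_sum, Finset.sum_mul]
  refine Finset.sum_congr rfl fun q _ => ?_
  by_cases h : cnd p q
  · rw [if_pos h, if_pos h, if_pos h, ← mul_add, hK p q h]
  · rw [if_neg h, if_neg h, if_neg h, add_zero, Complex.ofReal_zero, zero_mul]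

/-- **THE WEIGHTED BOND COUNT BY DIRECTION FOR A TWO-POINT FUNCTION.** For symmetric weights `τ` on the open
`r × c` box and any `F : box × box → ℂ` whose symmetrised values are constant on the four bond directions —
`F(p,q) + F(q,p) = K_V` on the `+e₁` steps `(i,j) → (i+1,j)`, `= K_H` on `(i,j) → (i,j+1)`, `= K_{D₁}` on
`(i,j) → (i+1,j+1)`, `= K_{D₂}` on `(i,j+1) → (i+1,j)` — the weighted sum over ordered adjacent pairs is
`Σ_{p ~ q or p ~~ q} τ(p,q) F(p,q) = wsumV τ·K_V + wsumH τ·K_H + wsumD₁ τ·K_{D₁} + wsumD₂ τ·K_{D₂}`.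
[cite: ValentiStolzeHirschfeld1991, §II] -/
theorem sum_ite_boxAdj_mul_eq_wsums (τ : Fin r ×ₗ Fin c → Fin r ×ₗ Fin c → ℝ) (hτ : ∀ x y, τ x y = τ y x)
    (F : Fin r ×ₗ Fin c → Fin r ×ₗ Fin c → ℂ) {KV KH KD₁ KD₂ : ℂ}
    (hV : ∀ p q : Fin r ×ₗ Fin c, ((ofLex p).1 : ℕ) + 1 = (ofLex q).1 ∧ (ofLex p).2 = (ofLex q).2 → F p q + F q p = KV)
    (hH : ∀ p q : Fin r ×ₗ Fin c, (ofLex p).1 = (ofLex q).1 ∧ ((ofLex p).2 : ℕ) + 1 = (ofLex q).2 → F p q + F q p = KH)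
    (hD₁ : ∀ p q : Fin r ×ₗ Fin c,
      ((ofLex p).1 : ℕ) + 1 = (ofLex q).1 ∧ ((ofLex p).2 : ℕ) + 1 = (ofLex q).2 → F p q + F q p = KD₁)
    (hD₂ : ∀ p q : Fin r ×ₗ Fin c,
      ((ofLex p).1 : ℕ) + 1 = (ofLex q).1 ∧ ((ofLex q).2 : ℕ) + 1 = (ofLex p).2 → F p q + F q p = KD₂) :
    (∑ p : Fin r ×ₗ Fin c, ∑ q : Fin r ×ₗ Fin c,
        if (rectBoxGraph r c).Adj p q ∨ (rectBoxDiagGraph r c).Adj p q then (τ p q : ℂ) * F p q else 0) =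
      (wsumV τ : ℂ) * KV + (wsumH τ : ℂ) * KH + (wsumD₁ τ : ℂ) * KD₁ + (wsumD₂ τ : ℂ) * KD₂ := by
  have split : ∀ p q : Fin r ×ₗ Fin c,
      (if (rectBoxGraph r c).Adj p q ∨ (rectBoxDiagGraph r c).Adj p q then (τ p q : ℂ) * F p q else 0) =
      ((if ((ofLex p).1 : ℕ) + 1 = (ofLex q).1 ∧ (ofLex p).2 = (ofLex q).2 then (τ p q : ℂ) * F p q else 0) +
        (if ((ofLex q).1 : ℕ) + 1 = (ofLex p).1 ∧ (ofLex q).2 = (ofLex p).2 then (τ p q : ℂ) * F p q else 0)) +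
      ((if (ofLex p).1 = (ofLex q).1 ∧ ((ofLex p).2 : ℕ) + 1 = (ofLex q).2 then (τ p q : ℂ) * F p q else 0) +
        (if (ofLex q).1 = (ofLex p).1 ∧ ((ofLex q).2 : ℕ) + 1 = (ofLex p).2 then (τ p q : ℂ) * F p q else 0)) +
      (((if ((ofLex p).1 : ℕ) + 1 = (ofLex q).1 ∧ ((ofLex p).2 : ℕ) + 1 = (ofLex q).2 then (τ p q : ℂ) * F p q else 0) +
        (if ((ofLex q).1 : ℕ) + 1 = (ofLex p).1 ∧ ((ofLex q).2 : ℕ) + 1 = (ofLex p).2 then (τ p q : ℂ) * F p q else 0)) +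
      ((if ((ofLex p).1 : ℕ) + 1 = (ofLex q).1 ∧ ((ofLex q).2 : ℕ) + 1 = (ofLex p).2 then (τ p q : ℂ) * F p q else 0) +
        (if ((ofLex q).1 : ℕ) + 1 = (ofLex p).1 ∧ ((ofLex p).2 : ℕ) + 1 = (ofLex q).2 then (τ p q : ℂ) * F p q else 0))) := by
    intro p q
    rw [ite_boxAdj_or_eq_add, ite_rectBoxGraph_adj_eq_sum_dirs, ite_rectBoxDiagGraph_adj_eq_sum_dirs]
  simp_rw [split]
  simp only [Finset.sum_add_distrib]
  rw [sum_ite_add_sum_ite_rev_eq_mul _ τ hτ F hV, sum_ite_add_sum_ite_rev_eq_mul _ τ hτ F hH,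
    sum_ite_add_sum_ite_rev_eq_mul _ τ hτ F hD₁, sum_ite_add_sum_ite_rev_eq_mul _ τ hτ F hD₂]
  unfold wsumV wsumH wsumD₁ wsumD₂
  ring

end ClusterLowerBound

end Literature.MathematicalPhysics.QuantumLattice

end
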